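import Summits.HodgeConjecture.HodgeConjecture.Theses.TropicalCuspLift

/-!
# Route TropicalCuspLift — `BaireSpreading` (item stmt-HodgeConjecture-2526)

The support item `BaireSpreading` of route `route-HodgeConjecture-TropicalCuspLift` is the
topological skeleton of the spreading step ("algebraic on a Euclidean-open subset of a component
of the Hodge locus ⇒ algebraic on the whole component"):

in a Baire space `S`, if countably many closed sets `Z i`, each of which is either all of `S` or has
empty interior, cover a non-empty open set `U`, then one of them is all of `S`.

Proof (Baire category theorem, Mathlib's `BaireSpace` API): otherwise every `Z i` is closed with
empty interior, hence nowhere dense (`IsClosed.isNowhereDense_iff`), hence meagre; a countable union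
of meagre sets is meagre (`isMeagre_iUnion`), so `U ⊆ ⋃ i, Z i` is meagre (`IsMeagre.mono`) — but a
non-empty open subset of a Baire space is not meagre (`not_isMeagre_of_isOpen`).
-/

-- `Summit.HodgeConjecture.HodgeConjecture.Theorems` is the mandated namespace (single-problem summit:
-- Problem = Summit), which `linter.dupNamespace` flags on every declaration; the lakefile turns the
-- linter off tree-wide (weak option), restated here so stand-alone elaboration is warning-free too.
set_option linter.dupNamespace false

namespace Summit.HodgeConjecture.HodgeConjecture.Theorems

/-- **Baire spreading** (item stmt-HodgeConjecture-2526, route TropicalCuspLift): in a Baire space,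
countably many closed sets each of which is either everything or has empty interior cannot cover a
non-empty open set unless one of them is everything.  By contraposition from the Baire category
theorem: closed sets with empty interior are nowhere dense, a countable union of them is meagre, and
a non-empty open subset of a Baire space is not meagre. -/
theorem tropicalCuspLift_baireSpreading_proof :
    Summit.HodgeConjecture.HodgeConjecture.Theses.TropicalCuspLift.BaireSpreading := by
  unfold Summit.HodgeConjecture.HodgeConjecture.Theses.TropicalCuspLift.BaireSpreading
  intro S _ _ Z hZc hZ U hU hUne hUsub
  by_contra hne
  -- every `Z i` is closed with empty interior, hence nowhere dense, hence meagre
  have hmeagre : ∀ i, IsMeagre (Z i) := fun i =>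
    (((hZc i).isNowhereDense_iff).2 ((hZ i).resolve_left fun h => hne ⟨i, h⟩)).isMeagre
  -- so the non-empty open set `U ⊆ ⋃ i, Z i` is meagre, contradicting the Baire property
  exact not_isMeagre_of_isOpen hU hUne ((isMeagre_iUnion hmeagre).mono hUsub)

end Summit.HodgeConjecture.HodgeConjecture.Theorems
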